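import Literature.NumberTheory.LFunctions.Zhang2022.RepairTheta
import Literature.NumberTheory.LFunctions.Zhang2022.MainTermFormCauchySchwarz

/-!
# Zhang (2022), repair rung F-S1R: formula I of the manuscript as a Gram form — `P(g,h) = M(g,h) + conj M(h,g)`

Y. Zhang, *Discrete mean estimates and the Landau–Siegel zero*, arXiv:2211.02515v1 [Zhang2022LandauSiegel] —
an unrefereed manuscript under adjudication; **nothing here asserts any of its claims, and nothing here is a
statement about Landau–Siegel zeros.** Repair rung of the cell (human ruling D-0077), Track K-S1 (RULING R3,
2026-08-26): the STRUCTURAL half of «not repairable in class» — the manuscript's main-term evaluations are values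
of ONE positive-semidefinite Hermitian form, so Cauchy–Schwarz forbids the §2 endgame for every design.

**Formula I** (Prop 7.1 with Lemmas 8.2/8.4, the evaluation used in §§8–10; pub-zhang STRUCTURE.md §2, the
«dipole rule»): at the main values of the shifts (`β_j = ijα`, `β_{j+1}β_{j+2} ↔ N_j = bN j`,
`β_{j+1}+β_{j+2} ↔ S_j = bS j`, `α log P = π`) the main-order constant of `Θ₁(a_g, a_{h̄})/(𝔞𝔓)` for
coefficient profiles `g`, `conj h` of the logarithmic variable `y = log n/log P` is the sesquilinear form
`M(g,h) = (1/π) Σ_j W_j ∫₀¹ (g′ + iπ b_j g)(y)·conj[h′ + iπS_j h + π²N_j ∫_y^1 h](y) dy` (`Mform`, weights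
`W = (1/2, 2, 3/2)` of Prop 7.1, `b = (1,2,3)`). **This file proves** (`mainTermFormPolar_eq_Mform`) that for
ONE-SIDED kinked profiles (`KinkedProfile`: continuous on `[0,1]`, right-differentiable inside, `g′ ∈ L²`;
`g(1) = h(1) = 0`) the tree's polar main-term form `P(g,h)` (`MainTermFormCauchySchwarz.mainTermFormPolar`, the
polarisation of STRUCTURE.md (4.1) = `MainTermFormPSD.mainTermForm`) satisfies
`P(g,h) = M(g,h) + conj M(h,g)` — i.e. `2Re Θ₁`-type constants are Gram values of the PSD form `𝔅`. The only
analysis is one integration by parts (`integral_deriv_mul_conj_primitive`: `∫₀¹ g′·conj S_h = −∫₀¹ g h̄` for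
`g(1) = 0`) and `∫₀¹ g′ = −g(0)`; the rest is the coefficient bookkeeping `ΣW_j = 4`, `ΣW_jS_j = 15`,
`ΣW_jN_j = 12`, `ΣW_jb_j = 9`, `ΣW_jb_jS_j = 32`, `ΣW_jb_jN_j = 24` (`Mform_eq_atoms`), which reproduces the
coefficients `8/π, 48, 88π = 64π + 24π, 48π², −24π` of (4.1). Companions: `RepairKappaProfile` (the
manuscript's `ϰ`-profiles are one-sided kinked profiles and satisfy the two pointwise dipole identities) and
`RepairPairFormGram` (the mollifier-pair block `frakc1T/frakc2T` of `RepairFrakc12Theta` equals `𝔅` on the pair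
profile, hence is `≥ 0` on the whole admissible class). All declarations are elementary calculus, tagged
`[cite: Zhang2022LandauSiegel, Prop 7.1 with (8.11)–(8.23), pp.44–50]` unless they transcribe a display.
-/

noncomputable section

open Complex Real ComplexConjugate Set MeasureTheory intervalIntegral

namespace Literature.NumberTheory.LFunctions.Zhang2022

namespace Repair

/-! ### Formula I of the manuscript (Prop 7.1 + §8) as a profile-generic sesquilinear form -/

/-- One `j`-summand of pub-zhang's «dipole rule» (STRUCTURE.md §2): the integrand
`(g′ + iπj g)(y) · conj[h′ + iπ(j′+j″) h + π² j′j″ ∫_y^1 h](y)` — the main terms of Lemma 8.2 (applied to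
the `m`-factor with profile `g`) and Lemma 8.4 (applied to the `n`-factor with profile `conj h`) at the
main values `β_j = ijα`, `(β_{j+1}, β_{j+2}) = (ij′α, ij″α)`. [cite: Zhang2022LandauSiegel, Prop 7.1, Lemmas 8.2/8.4] -/
def dipoleIntegrand (j : ℕ) (g g' h h' : ℝ → ℂ) (y : ℝ) : ℂ :=
  (g' y + I * π * (j : ℂ) * g y)
    * conj (h' y + I * π * ((bS j : ℝ) : ℂ) * h y + (π : ℂ) ^ 2 * ((bN j : ℝ) : ℂ) * ∫ t in y..1, h t)

/-- **Formula I as a sesquilinear form on profiles** (linear in `(g,g′)`, conjugate-linear in `(h,h′)`):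
`M(g,h) = (1/π) Σ_j W_j ∫₀¹ (g′+iπb_jg)·conj(h′+iπs_jh+π²N_j∫_y^1h)` with the manuscript's
`b = (1,2,3)`, cyclic complements `(j′,j″) = (2,3), (3,1), (1,2)` (`β₄ = β₁, β₅ = β₂`) and Prop 7.1's weights
`W = (1/2, 2, 3/2)`; `Θ₁(a_g, a_{h̄})/(𝔞𝔓) → M(g,h)` at main order for coefficient profiles `g`, `conj h`.
[cite: Zhang2022LandauSiegel, Prop 7.1, (8.11)–(8.12)] -/
def Mform (g g' h h' : ℝ → ℂ) : ℂ :=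
  (((1 / π : ℝ)) : ℂ) *
    (1 / 2 * (∫ y in (0:ℝ)..1, dipoleIntegrand 1 g g' h h' y)
      + 2 * (∫ y in (0:ℝ)..1, dipoleIntegrand 2 g g' h h' y)
      + 3 / 2 * (∫ y in (0:ℝ)..1, dipoleIntegrand 3 g g' h h' y))

/-! ### One-sided kinked profiles and the integration by parts -/

/-- A continuous profile on `[0,1]` with a marked RIGHT derivative at every interior point, square
integrable — the shape of the manuscript's piecewise poly×exp coefficient profiles (kinks allowed).
[cite: Zhang2022LandauSiegel, Prop 7.1 with (8.11)–(8.23), pp.44–50] -/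
structure KinkedProfile (g g' : ℝ → ℂ) : Prop where
  cont : ContinuousOn g (Icc 0 1)
  hasDeriv : ∀ x ∈ Ioo (0:ℝ) 1, HasDerivWithinAt g (g' x) (Ioi x) x
  memLp : MemLp g' 2 (volume.restrict (Ioc (0:ℝ) 1))

variable {g g' h h' : ℝ → ℂ}

/-- A kinked profile is an `H¹` profile. [cite: Zhang2022LandauSiegel, Prop 7.1 with (8.11)–(8.23), pp.44–50] -/
theorem KinkedProfile.isH1 (hg : KinkedProfile g g') : IsH1OnUnitInterval g g' :=
  isH1_of_hasDerivWithinAt_Ioi hg.cont hg.hasDeriv hg.memLp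

/-- `conj` commutes with the interval integral. [cite: Zhang2022LandauSiegel, Prop 7.1 with (8.11)–(8.23), pp.44–50] -/
private theorem conj_intervalIntegral (f : ℝ → ℂ) (a b : ℝ) :
    conj (∫ x in a..b, f x) = ∫ x in a..b, conj (f x) := by
  simp only [intervalIntegral, map_sub, integral_conj]

/-- Linearity of `∫₀¹` over four weighted integrable terms. [cite: Zhang2022LandauSiegel, Prop 7.1 with (8.11)–(8.23), pp.44–50] -/
private theorem integral_lin4 {f1 f2 f3 f4 : ℝ → ℂ} (c1 c2 c3 c4 : ℂ)
    (h1 : IntervalIntegrable f1 volume 0 1) (h2 : IntervalIntegrable f2 volume 0 1)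
    (h3 : IntervalIntegrable f3 volume 0 1) (h4 : IntervalIntegrable f4 volume 0 1) :
    ∫ x in (0:ℝ)..1, (c1 * f1 x + c2 * f2 x + c3 * f3 x + c4 * f4 x)
      = c1 * (∫ x in (0:ℝ)..1, f1 x) + c2 * (∫ x in (0:ℝ)..1, f2 x)
        + c3 * (∫ x in (0:ℝ)..1, f3 x) + c4 * (∫ x in (0:ℝ)..1, f4 x) := by
  rw [intervalIntegral.integral_add ((h1.const_mul c1).add ((h2.const_mul c2))|>.add (h3.const_mul c3))
      (h4.const_mul c4),
    intervalIntegral.integral_add ((h1.const_mul c1).add (h2.const_mul c2)) (h3.const_mul c3),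
    intervalIntegral.integral_add (h1.const_mul c1) (h2.const_mul c2),
    intervalIntegral.integral_const_mul, intervalIntegral.integral_const_mul,
    intervalIntegral.integral_const_mul, intervalIntegral.integral_const_mul]

/-- The primitive `S_h(x) = ∫₀ˣ h` has derivative `h(x)` at interior points (`h` continuous on `[0,1]`).
[cite: Zhang2022LandauSiegel, Prop 7.1 with (8.11)–(8.23), pp.44–50] -/
private theorem hasDerivAt_primitive_unit (hh : ContinuousOn h (Icc 0 1)) {x : ℝ} (hx : x ∈ Ioo (0:ℝ) 1) :
    HasDerivAt (fun y => ∫ t in (0:ℝ)..y, h t) (h x) x := by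
  have hint : IntervalIntegrable h volume 0 x :=
    (hh.mono (Icc_subset_Icc_right hx.2.le)).intervalIntegrable_of_Icc hx.1.le
  have hmeas : StronglyMeasurableAtFilter h (nhds x) volume :=
    ContinuousOn.stronglyMeasurableAtFilter isOpen_Ioo (hh.mono Ioo_subset_Icc_self) x hx
  have hcont : ContinuousAt h x := hh.continuousAt (Icc_mem_nhds hx.1 hx.2)
  exact intervalIntegral.integral_hasDerivAt_right hint hmeas hcont

/-- **Integration by parts against the primitive**: for a one-sided kinked profile `g` (`g(1) = 0`) and a
continuous `h`, `∫₀¹ g′·conj(S_h) = −∫₀¹ g·conj h`, `S_h(x) = ∫₀ˣ h`. [cite: Zhang2022LandauSiegel, Prop 7.1 with (8.11)–(8.23), pp.44–50] -/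
theorem integral_deriv_mul_conj_primitive (hg : KinkedProfile g g') (hg1 : g 1 = 0)
    (hh : ContinuousOn h (Icc 0 1)) :
    (∫ x in (0:ℝ)..1, g' x * conj (∫ t in (0:ℝ)..x, h t))
      = -∫ x in (0:ℝ)..1, g x * conj (h x) := by
  have hS : ContinuousOn (fun x => ∫ t in (0:ℝ)..x, h t) (Icc 0 1) := continuousOn_primitive_unit hh
  -- Φ = g · conj S_h
  have hΦc : ContinuousOn (fun x => g x * conj (∫ t in (0:ℝ)..x, h t)) (Icc 0 1) :=
    hg.cont.mul (continuousOn_conj_comp hS)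
  have hΦd : ∀ x ∈ Ioo (0:ℝ) 1, HasDerivWithinAt (fun x => g x * conj (∫ t in (0:ℝ)..x, h t))
      (g' x * conj (∫ t in (0:ℝ)..x, h t) + g x * conj (h x)) (Ioi x) x := by
    intro x hx
    exact (hg.hasDeriv x hx).mul (hasDerivAt_conj_comp (hasDerivAt_primitive_unit hh hx)).hasDerivWithinAt
  have hi1 : IntervalIntegrable (fun x => g' x * conj (∫ t in (0:ℝ)..x, h t)) volume 0 1 :=
    hg.isH1.intervalIntegrable.mul_continuousOn
      (by rw [uIcc_of_le zero_le_one]; exact continuousOn_conj_comp hS)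
  have hi2 : IntervalIntegrable (fun x => g x * conj (h x)) volume 0 1 :=
    (hg.cont.mul (continuousOn_conj_comp hh)).intervalIntegrable_of_Icc zero_le_one
  have key := intervalIntegral.integral_eq_sub_of_hasDeriv_right_of_le zero_le_one hΦc hΦd (hi1.add hi2)
  rw [intervalIntegral.integral_add hi1 hi2] at key
  simp only [hg1, zero_mul, intervalIntegral.integral_same, map_zero, mul_zero, sub_zero] at key
  linear_combination key

/-- `∫₀¹ g′ = −g(0)` for a one-sided profile. [cite: Zhang2022LandauSiegel, Prop 7.1 with (8.11)–(8.23), pp.44–50] -/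
theorem integral_deriv_eq_neg (hg : KinkedProfile g g') (hg1 : g 1 = 0) :
    (∫ x in (0:ℝ)..1, g' x) = -g 0 := by
  have := hg.isH1.eq_add_integral 1 ⟨zero_le_one, le_rfl⟩
  rw [hg1] at this
  linear_combination -this

/-- `conj ∫₀¹ u v̄ = ∫₀¹ v ū`. [cite: Zhang2022LandauSiegel, Prop 7.1 with (8.11)–(8.23), pp.44–50] -/
private theorem conj_integral_mul_conj (u v : ℝ → ℂ) :
    conj (∫ x in (0:ℝ)..1, u x * conj (v x)) = ∫ x in (0:ℝ)..1, v x * conj (u x) := by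
  rw [conj_intervalIntegral]
  refine intervalIntegral.integral_congr fun x _ => ?_
  simp only [map_mul, Complex.conj_conj]
  ring

/-- **One `j`-summand of formula I in closed «atom» form** for one-sided kinked profiles: with
`A₁ = ∫g′h̄′`, `A₂ = ∫g′h̄`, `A₄ = ∫gh̄′`, `A₅ = ∫gh̄`, `A₇ = ∫g·conj S_h`, `I_g = ∫g`, `I_h = ∫h`,
`∫₀¹ (g′+iπjg)conj(h′+iπsh+π²N∫_y^1h) = A₁ − iπsA₂ + π²N(A₅ − g(0)Ī_h) + iπjA₄ + π²jsA₅ + iπ³jN(I_gĪ_h − A₇)`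
(the tail `∫_y^1 h = I_h − S_h(y)`, `∫₀¹ g′ = −g(0)` and the integration by parts
`∫g′·conj S_h = −A₅`). [cite: Zhang2022LandauSiegel, Prop 7.1 with (8.11)–(8.23), pp.44–50] -/
theorem integral_dipoleIntegrand_eq (hg : KinkedProfile g g') (hh : KinkedProfile h h')
    (hg1 : g 1 = 0) (j : ℕ) :
    ∫ y in (0:ℝ)..1, dipoleIntegrand j g g' h h' y
      = (∫ x in (0:ℝ)..1, g' x * conj (h' x))
        - I * π * ((bS j : ℝ) : ℂ) * (∫ x in (0:ℝ)..1, g' x * conj (h x))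
        + (π : ℂ) ^ 2 * ((bN j : ℝ) : ℂ)
            * ((∫ x in (0:ℝ)..1, g x * conj (h x)) - g 0 * conj (∫ x in (0:ℝ)..1, h x))
        + I * π * (j : ℂ) * (∫ x in (0:ℝ)..1, g x * conj (h' x))
        + (π : ℂ) ^ 2 * (j : ℂ) * ((bS j : ℝ) : ℂ) * (∫ x in (0:ℝ)..1, g x * conj (h x))
        + I * (π : ℂ) ^ 3 * (j : ℂ) * ((bN j : ℝ) : ℂ)
            * ((∫ x in (0:ℝ)..1, g x) * conj (∫ x in (0:ℝ)..1, h x)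
                - ∫ x in (0:ℝ)..1, g x * conj (∫ t in (0:ℝ)..x, h t)) := by
  have hgH := hg.isH1
  have hhH := hh.isH1
  -- integrability of the eight atoms
  have i1 : IntervalIntegrable (fun x => g' x * conj (h' x)) volume 0 1 :=
    IsH1OnUnitInterval.intervalIntegrable_deriv_mul_conj_deriv hgH hhH
  have i2 : IntervalIntegrable (fun x => g' x * conj (h x)) volume 0 1 :=
    IsH1OnUnitInterval.intervalIntegrable_deriv_mul_conj hgH hhH
  have i3 : IntervalIntegrable g' volume 0 1 := hgH.intervalIntegrable
  have hS : ContinuousOn (fun x => ∫ t in (0:ℝ)..x, h t) (Icc 0 1) := continuousOn_primitive_unit hh.cont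
  have i4 : IntervalIntegrable (fun x => g' x * conj (∫ t in (0:ℝ)..x, h t)) volume 0 1 :=
    i3.mul_continuousOn (by rw [uIcc_of_le zero_le_one]; exact continuousOn_conj_comp hS)
  have hch' : IntervalIntegrable (fun x => conj (h' x)) volume 0 1 := by
    rw [intervalIntegrable_iff, uIoc_of_le zero_le_one]
    exact hhH.memLp_conj.integrable one_le_two
  have i5 : IntervalIntegrable (fun x => g x * conj (h' x)) volume 0 1 :=
    hch'.continuousOn_mul (by rw [uIcc_of_le zero_le_one]; exact hg.cont)
  have i6 : IntervalIntegrable (fun x => g x * conj (h x)) volume 0 1 :=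
    IsH1OnUnitInterval.intervalIntegrable_mul_conj hgH hhH
  have i7 : IntervalIntegrable g volume 0 1 := hg.cont.intervalIntegrable_of_Icc zero_le_one
  have i8 : IntervalIntegrable (fun x => g x * conj (∫ t in (0:ℝ)..x, h t)) volume 0 1 :=
    IsH1OnUnitInterval.intervalIntegrable_mul_conj_primitive hgH hhH
  have ih : IntervalIntegrable h volume 0 1 := hh.cont.intervalIntegrable_of_Icc zero_le_one
  -- abbreviations
  set Ih : ℂ := ∫ x in (0:ℝ)..1, h x with hIh
  -- pointwise expansion on [0,1]
  have hpt : EqOn (dipoleIntegrand j g g' h h')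
      (fun x => (1 * (g' x * conj (h' x)) + (-(I * π * ((bS j : ℝ) : ℂ))) * (g' x * conj (h x))
          + ((π : ℂ) ^ 2 * ((bN j : ℝ) : ℂ) * conj Ih) * g' x
          + (-((π : ℂ) ^ 2 * ((bN j : ℝ) : ℂ))) * (g' x * conj (∫ t in (0:ℝ)..x, h t)))
        + ((I * π * (j : ℂ)) * (g x * conj (h' x))
          + ((π : ℂ) ^ 2 * (j : ℂ) * ((bS j : ℝ) : ℂ)) * (g x * conj (h x))
          + (I * (π : ℂ) ^ 3 * (j : ℂ) * ((bN j : ℝ) : ℂ) * conj Ih) * g x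
          + (-(I * (π : ℂ) ^ 3 * (j : ℂ) * ((bN j : ℝ) : ℂ))) * (g x * conj (∫ t in (0:ℝ)..x, h t))))
      (uIcc 0 1) := by
    intro x hx
    rw [uIcc_of_le zero_le_one] at hx
    have htail : (∫ t in x..1, h t) = Ih - ∫ t in (0:ℝ)..x, h t := by
      rw [hIh, intervalIntegral.integral_interval_sub_left ih (intervalIntegrable_mono_unit ih hx)]
    unfold dipoleIntegrand
    rw [htail]
    simp only [map_add, map_sub, map_mul, map_pow, Complex.conj_I, Complex.conj_ofReal]
    linear_combination (-(π : ℂ) ^ 2 * (j : ℂ) * g x * ((bS j : ℝ) : ℂ) * conj (h x)) * Complex.I_sq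
  rw [intervalIntegral.integral_congr hpt,
    intervalIntegral.integral_add
      ((((i1.const_mul _).add (i2.const_mul _)).add (i3.const_mul _)).add (i4.const_mul _))
      ((((i5.const_mul _).add (i6.const_mul _)).add (i7.const_mul _)).add (i8.const_mul _)),
    integral_lin4 _ _ _ _ i1 i2 i3 i4, integral_lin4 _ _ _ _ i5 i6 i7 i8,
    integral_deriv_eq_neg hg hg1, integral_deriv_mul_conj_primitive hg hg1 hh.cont]
  ring

/-- **Formula I in atom form** for one-sided kinked profiles (`ΣW_j = 4`, `ΣW_js_j = 15`, `ΣW_jN_j = 12`,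
`ΣW_jb_j = 9`, `ΣW_jb_js_j = 32`, `ΣW_jb_jN_j = 24`):
`M(g,h) = (1/π)[4A₁ − 15iπA₂ + 9iπA₄ + 44π²A₅ − 12π²g(0)Ī_h + 24iπ³(I_gĪ_h − A₇)]`. [cite: Zhang2022LandauSiegel, Prop 7.1 with (8.11)–(8.23), pp.44–50] -/
theorem Mform_eq_atoms (hg : KinkedProfile g g') (hh : KinkedProfile h h') (hg1 : g 1 = 0) :
    Mform g g' h h' = (((1 / π : ℝ)) : ℂ) *
      (4 * (∫ x in (0:ℝ)..1, g' x * conj (h' x))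
        - 15 * I * π * (∫ x in (0:ℝ)..1, g' x * conj (h x))
        + 9 * I * π * (∫ x in (0:ℝ)..1, g x * conj (h' x))
        + 44 * (π : ℂ) ^ 2 * (∫ x in (0:ℝ)..1, g x * conj (h x))
        - 12 * (π : ℂ) ^ 2 * (g 0 * conj (∫ x in (0:ℝ)..1, h x))
        + 24 * I * (π : ℂ) ^ 3 * ((∫ x in (0:ℝ)..1, g x) * conj (∫ x in (0:ℝ)..1, h x)
            - ∫ x in (0:ℝ)..1, g x * conj (∫ t in (0:ℝ)..x, h t))) := by
  unfold Mform
  rw [integral_dipoleIntegrand_eq hg hh hg1, integral_dipoleIntegrand_eq hg hh hg1,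
    integral_dipoleIntegrand_eq hg hh hg1, bS_one, bS_two, bS_three, bN_one, bN_two, bN_three]
  push_cast
  ring

/-- **The Gram identity**: on one-sided kinked profiles the tree's polar main-term form
`P(g,h)` (`MainTermFormCauchySchwarz.mainTermFormPolar`, STRUCTURE.md (4.1) polarised) IS formula I
symmetrised: `P(g,h) = M(g,h) + conj M(h,g)`. One integration by parts; the boundary terms of (4.1) that
involve `g(1), h(1)` vanish by one-sidedness. [cite: Zhang2022LandauSiegel, Prop 7.1 with (8.11)–(8.23), pp.44–50] -/
theorem mainTermFormPolar_eq_Mform (hg : KinkedProfile g g') (hh : KinkedProfile h h')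
    (hg1 : g 1 = 0) (hh1 : h 1 = 0) :
    mainTermFormPolar g g' h h' = Mform g g' h h' + conj (Mform h h' g g') := by
  rw [Mform_eq_atoms hg hh hg1, Mform_eq_atoms hh hg hh1]
  unfold mainTermFormPolar mainTermFormSesq
  rw [hg1, hh1]
  have hπ : (π : ℂ) ≠ 0 := by exact_mod_cast Real.pi_ne_zero
  have c1 := conj_integral_mul_conj h' g'
  have c2 := conj_integral_mul_conj h' g
  have c4 := conj_integral_mul_conj h g'
  have c5 := conj_integral_mul_conj h g
  simp only [map_add, map_sub, map_mul, map_pow, Complex.conj_conj, Complex.conj_I,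
    Complex.conj_ofReal, map_ofNat, map_zero, mul_zero, sub_zero, add_zero, c1, c2, c4, c5]
  push_cast
  field_simp
  ring


/-! ### Linear combinations of profiles -/

/-- Kinked profiles form a complex vector space (closure under `u + t·f`). [cite: Zhang2022LandauSiegel, Prop 7.1 with (8.11)–(8.23), pp.44–50] -/
theorem KinkedProfile.add_smul {u u' f f' : ℝ → ℂ} (hu : KinkedProfile u u') (hf : KinkedProfile f f')
    (t : ℂ) : KinkedProfile (fun x => u x + t * f x) (fun x => u' x + t * f' x) where
  cont := hu.cont.add (continuousOn_const.mul hf.cont)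
  hasDeriv := fun x hx => (hu.hasDeriv x hx).add ((hf.hasDeriv x hx).const_mul t)
  memLp := hu.memLp.add (hf.memLp.const_mul t)

/-- The zero profile. [cite: Zhang2022LandauSiegel, Prop 7.1 with (8.11)–(8.23), pp.44–50] -/
theorem kinkedProfile_zero : KinkedProfile (fun _ => (0:ℂ)) (fun _ => (0:ℂ)) where
  cont := continuousOn_const
  hasDeriv := fun x _ => hasDerivWithinAt_const x _ _
  memLp := by simp

/-- Scalar multiples of a kinked profile. [cite: Zhang2022LandauSiegel, Prop 7.1 with (8.11)–(8.23), pp.44–50] -/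
theorem KinkedProfile.smul {f f' : ℝ → ℂ} (hf : KinkedProfile f f') (t : ℂ) :
    KinkedProfile (fun x => t * f x) (fun x => t * f' x) := by
  have := kinkedProfile_zero.add_smul hf t
  simpa using this

/-- `s(0, v) = 0`. [cite: Zhang2022LandauSiegel, Prop 7.1 with (8.11)–(8.23), pp.44–50] -/
theorem mainTermFormSesq_zero_left (v v' : ℝ → ℂ) :
    mainTermFormSesq (fun _ => (0:ℂ)) (fun _ => (0:ℂ)) v v' = 0 := by
  unfold mainTermFormSesq; simp

/-- `s(u, 0) = 0`. [cite: Zhang2022LandauSiegel, Prop 7.1 with (8.11)–(8.23), pp.44–50] -/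
theorem mainTermFormSesq_zero_right (u u' : ℝ → ℂ) :
    mainTermFormSesq u u' (fun _ => (0:ℂ)) (fun _ => (0:ℂ)) = 0 := by
  unfold mainTermFormSesq; simp

/-- `s(t·f, v) = t·s(f,v)`. [cite: Zhang2022LandauSiegel, Prop 7.1 with (8.11)–(8.23), pp.44–50] -/
theorem mainTermFormSesq_smul_left {f f' v v' : ℝ → ℂ} (hf : IsH1OnUnitInterval f f')
    (hv : IsH1OnUnitInterval v v') (t : ℂ) :
    mainTermFormSesq (fun x => t * f x) (fun x => t * f' x) v v' = t * mainTermFormSesq f f' v v' := by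
  have h0 : IsH1OnUnitInterval (fun _ => (0:ℂ)) (fun _ => (0:ℂ)) := kinkedProfile_zero.isH1
  have := mainTermFormSesq_add_smul_left h0 hf hv t
  simp only [zero_add, mainTermFormSesq_zero_left] at this
  exact this

/-- `s(u, t·f) = conj t · s(u,f)`. [cite: Zhang2022LandauSiegel, Prop 7.1 with (8.11)–(8.23), pp.44–50] -/
theorem mainTermFormSesq_smul_right {u u' f f' : ℝ → ℂ} (hu : IsH1OnUnitInterval u u')
    (hf : IsH1OnUnitInterval f f') (t : ℂ) :
    mainTermFormSesq u u' (fun x => t * f x) (fun x => t * f' x) = conj t * mainTermFormSesq u u' f f' := by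
  have h0 : IsH1OnUnitInterval (fun _ => (0:ℂ)) (fun _ => (0:ℂ)) := kinkedProfile_zero.isH1
  have := mainTermFormSesq_add_smul_right hu h0 hf t
  simp only [zero_add, mainTermFormSesq_zero_right] at this
  exact this


end Repair

end Literature.NumberTheory.LFunctions.Zhang2022
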